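import Summits.QuantumFields.YangMills.Theorems.DiagonalMirrorRPRWilsonDiagonalModelSchurCut

/-!
# Crux `DiagonalMirrorRPR` (stmt-QuantumFields-10604), line `sign-twisted-diagonal-trace`, construction F1_diag
# (director-ym O4 WORD 3 (A)): gluing half layers is a MEASURE-PRESERVING equivalence `HalfCfg × HalfCfg ≃ᵐ LayerCfg`

Helper for the crux `DiagonalMirrorRPR` of `YangMills` (routes `IsotropyFromPowerCounting`, `MirrorModularBoosts`,
`PencilRigidity`; item stmt-QuantumFields-10604), attached `--supports … --as helper`; it closes nothing by itself.
Continuation of `…WilsonDiagonalModelHalfSteps` / `…SchurCut` (`glue`, `bonds`, `inslab`, `halfHaar`): the bookkeeping that lets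
the cyclic chain of the two-step kernel `K_u` on layers (`diagCyclicTraceU`, product `layerHaar`) be rewritten over pairs
(bond half, in-slab half) with product measure `halfHaar ⊗ halfHaar` — step S4b of ROADMAP-F1diag v3 toward the trace formulas
`Σ κ_i^m = diagCyclicTraceU ρ β m`.

* `labelEquiv : (SlabSite × Fin 2) ⊕ (SlabSite × Fin 2) ≃ LayerIdx` (bond labels `0,1` first, in-slab labels `2,3` second),
  `labelEquiv_inl/inr`;
* `glueEquiv : HalfCfg × HalfCfg ≃ᵐ LayerCfg` (`MeasurableEquiv.sumPiEquivProdPi` + `piCongrLeft`), ★ `glueEquiv_apply`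
  (`glueEquiv (Y, X) = glue Y X`), ★ `measurePreserving_glueEquiv` (`halfHaar ⊗ halfHaar ↦ layerHaar`).

HONEST FRAMING: bookkeeping helper; no `def wilsonDiagonalModel`; nothing about D_old ⟨10604⟩, the RP crux of the FOLD restate,
or the summit is proved; the Yang–Mills mass gap is NOT proved here or anywhere in the tree.
-/

set_option autoImplicit false

noncomputable section

open MeasureTheory
open Literature.MathematicalPhysics.QuantumLattice Literature.MathematicalPhysics.QuantumFieldTheory
open Summit.QuantumFields.YangMills.Cruxes.DiagonalMirrorRPR.ParityBridgeColdTraces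

namespace Summit.QuantumFields.YangMills.Cruxes.DiagonalMirrorRPR.SignTwistedDiagonalTrace.WilsonDiagonal

/-! ## §21 Gluing half layers is a measure-preserving equivalence `HalfCfg × HalfCfg ≃ᵐ LayerCfg` -/

section Glue

variable {S : ℕ}

/-- The label equivalence: bond labels `0,1` and in-slab labels `2,3` of a layer from two copies of `Fin 2`. -/
def labelEquiv : (SlabSite S S × Fin 2) ⊕ (SlabSite S S × Fin 2) ≃ LayerIdx S S :=
  (Equiv.prodSumDistrib (SlabSite S S) (Fin 2) (Fin 2)).symm.trans ((Equiv.refl _).prodCongr finSumFinEquiv)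

/-- Bond labels come first: `inl (s, i) ↦ (s, i)` (`i = 0, 1`). -/
@[simp] theorem labelEquiv_inl (s : SlabSite S S) (i : Fin 2) :
    labelEquiv (Sum.inl (s, i)) = (s, Fin.castAdd 2 i) := by
  simp [labelEquiv]
  fin_cases i <;> rfl

/-- In-slab labels come second: `inr (s, i) ↦ (s, 2 + i)`. -/
@[simp] theorem labelEquiv_inr (s : SlabSite S S) (i : Fin 2) :
    labelEquiv (Sum.inr (s, i)) = (s, Fin.natAdd 2 i) := by
  simp [labelEquiv]
  fin_cases i <;> rfl

variable {G : Type*} [MeasurableSpace G]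

/-- **The glue equivalence** `HalfCfg × HalfCfg ≃ᵐ LayerCfg` (bond half, in-slab half) ↦ layer, as a measurable equivalence
assembled from `MeasurableEquiv.sumPiEquivProdPi` and `piCongrLeft`. -/
def glueEquiv : HalfCfg S S G × HalfCfg S S G ≃ᵐ LayerCfg S S G :=
  (MeasurableEquiv.sumPiEquivProdPi fun _ : (SlabSite S S × Fin 2) ⊕ (SlabSite S S × Fin 2) => G).symm.trans
    (MeasurableEquiv.piCongrLeft (fun _ : LayerIdx S S => G) labelEquiv)

/-- The glue equivalence IS `glue`. -/
theorem glueEquiv_apply (Y X : HalfCfg S S G) : glueEquiv (Y, X) = glue Y X := by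
  funext ⟨s, i⟩
  -- evaluate the transported function at `(s, i)` through `labelEquiv.symm`
  have key : ∀ q : (SlabSite S S × Fin 2) ⊕ (SlabSite S S × Fin 2),
      glueEquiv (Y, X) (labelEquiv q) = glue Y X (labelEquiv q) := by
    intro q
    simp only [glueEquiv, MeasurableEquiv.trans_apply, MeasurableEquiv.coe_piCongrLeft,
      Equiv.piCongrLeft_apply_apply]
    rcases q with ⟨s, j⟩ | ⟨s, j⟩
    · rw [labelEquiv_inl]
      fin_cases j <;> simp [MeasurableEquiv.sumPiEquivProdPi, Equiv.sumPiEquivProdPi, glue]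
    · rw [labelEquiv_inr]
      fin_cases j <;> simp [MeasurableEquiv.sumPiEquivProdPi, Equiv.sumPiEquivProdPi, glue]
  have := key (labelEquiv.symm (s, i))
  simpa using this

variable [Group G] [TopologicalSpace G] [IsTopologicalGroup G] [CompactSpace G] [BorelSpace G] [NeZero S]

/-- ★ **Gluing preserves Haar measure**: `halfHaar ⊗ halfHaar ↦ layerHaar` under `glueEquiv`. -/
theorem measurePreserving_glueEquiv :
    MeasurePreserving (glueEquiv : HalfCfg S S G × HalfCfg S S G ≃ᵐ LayerCfg S S G)
      ((halfHaar S G).prod (halfHaar S G)) (layerHaar S S G) := by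
  unfold glueEquiv halfHaar layerHaar
  refine MeasurePreserving.trans ?_ (measurePreserving_piCongrLeft (μ := fun _ : LayerIdx S S => haarProbability G) labelEquiv)
  exact (measurePreserving_sumPiEquivProdPi fun _ : (SlabSite S S × Fin 2) ⊕ (SlabSite S S × Fin 2) => haarProbability G).symm _

end Glue

end Summit.QuantumFields.YangMills.Cruxes.DiagonalMirrorRPR.SignTwistedDiagonalTrace.WilsonDiagonal

end
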